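import Summits.QuantumFields.BalabanUV.T4Continuum.Support.NE7K1LinWalkParametrix

/-!
# NE7K1LinWalkPadE — row NE7 (node U5), candidate route HOM, path H1L, cell K1-lin(s): THE PADDED OPERATOR `P ⊕ 1` ALONG AN INJECTION OF
# INDEX TYPES (a map `φ : ι → κ` with a partial inverse `ψ : κ → Option ι`) — coercivity, (H-comm) and cut-off compatibility TRANSFER from `P`,
# and `(padE P)⁻¹ = padE P⁻¹`

Lineage `b2b-balaban-t4-ne7-p2` (CRUX PROVER NE7 #2), generation 71; series (RW) file 25 (pure finite linear algebra over file 1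
`NE7K1LinWalkParametrix`).  File 23 `NE7K1LinWalkPad` pads a matrix on a sub-finset `Ω ⊆ Ω₀` of ONE type; the two-cutoff LINE's extended
operator `𝒫♮(s)` of files 9 ∕ 14 lives on the SUM type `Idx L R′ = ↥(R′.image (blk L)) ⊕ ↥(R′.image (blk L)) × NZ d L`, and the passage from a
region `R′` to a larger one `R′₀` is an INJECTION `Idx L R′ → Idx L R′₀`, not a finset inclusion.  THIS FILE redoes file 23 for that setting
([folklore]): an index map `φ : ι → κ` together with a partial inverse `ψ : κ → Option ι` (`ψ (φ c) = some c`; `ψ x = some c ⇒ φ c = x`), and for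
a matrix `P` on `ι` the PADDED OPERATOR `padE ψ P` on `κ` = `P` on the image of `φ`, the IDENTITY off it, no coupling between the two:

* `padE_apply_*`, `padE_phi`; `sum_elim` (a sum over `κ` of the zero-extension along `ψ` is the sum over `ι`); `padE_mulVec`;
* `padE_form`: `⟨v, padE P v⟩ = ⟨v∘φ, P(v∘φ)⟩ + Σ_{ψ x = none} v_x²` ⇒ **`padE_coercive`** (floor `min(σ,1)`);
* `padE_mul`, `padE_one` ⇒ **`padE_inv`**: `(padE P)⁻¹ = padE P⁻¹`, so `(padE P)⁻¹(φ c, φ c′) = P⁻¹(c, c′)` (`padE_phi`);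
* `comm_padE_mulVec ∕ comm_padE_sq` ⇒ **`hcomm_padE`**: B4 Lemma 2.1's (H-comm) shape TRANSFERS from `P` (cut-off `l ∘ φ`) to `padE P` (cut-off `l`)
  with the SAME constants;
* **`cutoffOn_padE`**: `NE7K1LinWalkParametrix.CutoffOn (padE P) l S` from `CutoffOn P (l ∘ φ) (φ⁻¹ S)` and `supp l ⊆ S` — NO agreement of
  off-diagonal entries with a second operator is needed (for the line they do not agree near `∂Ω`).

HONEST FRAMING: [folklore] finite linear algebra; no lattice, no operator of Bałaban's (the line's `δG` clause instantiates); no `sorry`.  Census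
only; NO letter ∕ tag ∕ size of NE7 moves; NE7 NOT PRINTED ∕ NOT PROVED; spine 0∕9; FIXED FINITE T⁴, rung (B)+1; NOT infinite volume, NOT mass gap,
NOT Clay.  HONEST DEPENDENCY: continuum YM on T⁴ ⇐ BetaPertH ∧ nine spine estimates (0/9 proved); BetaPertH ⇐ (D1) ∧ (D4) ∧ CAP+tail; G-an2-4
gates asym, D1 and NE2/3/4.
-/

noncomputable section

open Finset Matrix

namespace Summit.QuantumFields.BalabanUV.T4Continuum.NE7K1LinWalkPadE

open NE7K1LinWalkParametrix

variable {ι κ : Type*} [Fintype ι] [Fintype κ] [DecidableEq κ]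

/-- **THE PADDED OPERATOR ALONG `(φ, ψ)`**: `P c c′` at `(x, y)` with `ψ x = some c`, `ψ y = some c′`; `0` from the image to its complement;
the IDENTITY off the image. [folklore] -/
def padE (ψ : κ → Option ι) (P : Matrix ι ι ℝ) : Matrix κ κ ℝ :=
  Matrix.of fun x y => match ψ x, ψ y with
    | some c, some c' => P c c'
    | some _, none => 0
    | none, _ => if y = x then 1 else 0

omit [Fintype ι] [Fintype κ] in
/-- entries inside the image. [folklore] -/
theorem padE_apply_some_some (ψ : κ → Option ι) (P : Matrix ι ι ℝ) {x y : κ} {c c' : ι} (hx : ψ x = some c)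
    (hy : ψ y = some c') : padE ψ P x y = P c c' := by
  simp only [padE, Matrix.of_apply, hx, hy]

omit [Fintype ι] [Fintype κ] in
/-- no coupling from the image to its complement. [folklore] -/
theorem padE_apply_some_none (ψ : κ → Option ι) (P : Matrix ι ι ℝ) {x y : κ} {c : ι} (hx : ψ x = some c) (hy : ψ y = none) :
    padE ψ P x y = 0 := by
  simp only [padE, Matrix.of_apply, hx, hy]

omit [Fintype ι] [Fintype κ] in
/-- identity rows off the image. [folklore] -/
theorem padE_apply_none (ψ : κ → Option ι) (P : Matrix ι ι ℝ) {x : κ} (hx : ψ x = none) (y : κ) :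
    padE ψ P x y = if y = x then 1 else 0 := by
  simp only [padE, Matrix.of_apply, hx]

omit [Fintype ι] [Fintype κ] in
/-- at image points the padded operator is `P`. [folklore] -/
theorem padE_phi {φ : ι → κ} {ψ : κ → Option ι} (hψφ : ∀ c, ψ (φ c) = some c) (P : Matrix ι ι ℝ) (c c' : ι) :
    padE ψ P (φ c) (φ c') = P c c' :=
  padE_apply_some_some ψ P (hψφ c) (hψφ c')

omit [DecidableEq κ] in
/-- **SUMS OF ZERO-EXTENSIONS**: `Σ_{y : κ} (ψ y).elim 0 f = Σ_{c : ι} f c`. [folklore] -/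
theorem sum_elim {φ : ι → κ} {ψ : κ → Option ι} (hψφ : ∀ c, ψ (φ c) = some c) (hφψ : ∀ x c, ψ x = some c → φ c = x)
    (f : ι → ℝ) : ∑ y : κ, (ψ y).elim 0 f = ∑ c : ι, f c := by
  classical
  have h1 : ∀ y : κ, (ψ y).elim 0 f = ∑ c : ι, (if ψ y = some c then f c else 0) := by
    intro y
    cases h : ψ y with
    | none => simp
    | some c₀ => simp [Option.some.injEq]
  simp_rw [h1]
  rw [Finset.sum_comm]
  refine Finset.sum_congr rfl fun c _ => ?_
  rw [Finset.sum_eq_single (φ c) (fun y _ hy => ?_) (fun h => absurd (Finset.mem_univ _) h)]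
  · rw [if_pos (hψφ c)]
  · rw [if_neg]
    intro h
    exact hy (hφψ y c h).symm

/-- **THE PADDED OPERATOR APPLIED TO A VECTOR**: `P(v∘φ)` on the image, `v` off it. [folklore] -/
theorem padE_mulVec {φ : ι → κ} {ψ : κ → Option ι} (hψφ : ∀ c, ψ (φ c) = some c) (hφψ : ∀ x c, ψ x = some c → φ c = x)
    (P : Matrix ι ι ℝ) (v : κ → ℝ) (x : κ) :
    (padE ψ P *ᵥ v) x = (ψ x).elim (v x) (fun c => (P *ᵥ (v ∘ φ)) c) := by
  simp only [mulVec, dotProduct]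
  cases hx : ψ x with
  | none =>
    simp only [Option.elim]
    simp_rw [padE_apply_none ψ P hx]
    simp
  | some c =>
    simp only [Option.elim]
    have h : ∀ y : κ, padE ψ P x y * v y = (ψ y).elim 0 (fun c' => P c c' * (v ∘ φ) c') := by
      intro y
      cases hy : ψ y with
      | none => rw [padE_apply_some_none ψ P hx hy, zero_mul]; rfl
      | some c' =>
        rw [padE_apply_some_some ψ P hx hy]
        show P c c' * v y = P c c' * v (φ c')
        rw [hφψ y c' hy]
    simp_rw [h]
    exact sum_elim hψφ hφψ _

omit [DecidableEq κ] in
/-- the squared norm splits into the image part and the rest. [folklore] -/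
theorem dot_split {φ : ι → κ} {ψ : κ → Option ι} (hψφ : ∀ c, ψ (φ c) = some c) (hφψ : ∀ x c, ψ x = some c → φ c = x)
    (v : κ → ℝ) : v ⬝ᵥ v = (v ∘ φ) ⬝ᵥ (v ∘ φ) + ∑ x ∈ univ.filter (fun x : κ => ψ x = none), v x * v x := by
  simp only [dotProduct, Finset.sum_filter]
  have h : ∀ x : κ, v x * v x = (ψ x).elim 0 (fun c => (v ∘ φ) c * (v ∘ φ) c) + (if ψ x = none then v x * v x else 0) := by
    intro x
    cases hx : ψ x with
    | none => simp
    | some c =>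
      simp only [Option.elim, reduceCtorEq, if_false, add_zero]
      show v x * v x = v (φ c) * v (φ c)
      rw [hφψ x c hx]
  rw [Finset.sum_congr rfl fun x _ => h x, Finset.sum_add_distrib, sum_elim hψφ hφψ]

/-- **THE FORM OF THE PADDED OPERATOR**: `⟨v, padE P v⟩ = ⟨v∘φ, P(v∘φ)⟩ + Σ_{ψ x = none} v_x²`. [folklore] -/
theorem padE_form {φ : ι → κ} {ψ : κ → Option ι} (hψφ : ∀ c, ψ (φ c) = some c) (hφψ : ∀ x c, ψ x = some c → φ c = x)
    (P : Matrix ι ι ℝ) (v : κ → ℝ) :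
    v ⬝ᵥ padE ψ P *ᵥ v = (v ∘ φ) ⬝ᵥ P *ᵥ (v ∘ φ) + ∑ x ∈ univ.filter (fun x : κ => ψ x = none), v x * v x := by
  simp only [dotProduct, Finset.sum_filter]
  have h : ∀ x : κ, v x * (padE ψ P *ᵥ v) x =
      (ψ x).elim 0 (fun c => (v ∘ φ) c * (P *ᵥ (v ∘ φ)) c) + (if ψ x = none then v x * v x else 0) := by
    intro x
    rw [padE_mulVec hψφ hφψ]
    cases hx : ψ x with
    | none => simp
    | some c =>
      simp only [Option.elim, reduceCtorEq, if_false, add_zero]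
      show v x * (P *ᵥ (v ∘ φ)) c = v (φ c) * (P *ᵥ (v ∘ φ)) c
      rw [hφψ x c hx]
  rw [Finset.sum_congr rfl fun x _ => h x, Finset.sum_add_distrib, sum_elim hψφ hφψ]

/-- **THE PADDED OPERATOR IS COERCIVE** with floor `min(σ,1)` when `P` is `σ`-coercive. [folklore] -/
theorem padE_coercive {φ : ι → κ} {ψ : κ → Option ι} (hψφ : ∀ c, ψ (φ c) = some c) (hφψ : ∀ x c, ψ x = some c → φ c = x)
    (P : Matrix ι ι ℝ) {σ : ℝ} (hPc : ∀ w, σ * (w ⬝ᵥ w) ≤ w ⬝ᵥ P *ᵥ w) (v : κ → ℝ) :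
    min σ 1 * (v ⬝ᵥ v) ≤ v ⬝ᵥ padE ψ P *ᵥ v := by
  rw [padE_form hψφ hφψ, dot_split hψφ hφψ v, mul_add]
  have h0 : 0 ≤ (v ∘ φ) ⬝ᵥ (v ∘ φ) := Finset.sum_nonneg fun i _ => mul_self_nonneg _
  have h1 : min σ 1 * ((v ∘ φ) ⬝ᵥ (v ∘ φ)) ≤ (v ∘ φ) ⬝ᵥ P *ᵥ (v ∘ φ) :=
    (mul_le_mul_of_nonneg_right (min_le_left σ 1) h0).trans (hPc _)
  have h2 : min σ 1 * ∑ x ∈ univ.filter (fun x : κ => ψ x = none), v x * v x ≤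
      ∑ x ∈ univ.filter (fun x : κ => ψ x = none), v x * v x := by
    have h0' : 0 ≤ ∑ x ∈ univ.filter (fun x : κ => ψ x = none), v x * v x := Finset.sum_nonneg fun x _ => mul_self_nonneg _
    nlinarith [min_le_right σ 1]
  exact add_le_add h1 h2

/-- `padE` is multiplicative. [folklore] -/
theorem padE_mul {φ : ι → κ} {ψ : κ → Option ι} (hψφ : ∀ c, ψ (φ c) = some c) (hφψ : ∀ x c, ψ x = some c → φ c = x)
    (P Q : Matrix ι ι ℝ) : padE ψ (P * Q) = padE ψ P * padE ψ Q := by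
  ext x z
  rw [Matrix.mul_apply]
  cases hx : ψ x with
  | none =>
    simp_rw [padE_apply_none ψ P hx]
    simp only [ite_mul, one_mul, zero_mul, Finset.sum_ite_eq', Finset.mem_univ, if_true]
    rw [padE_apply_none ψ (P * Q) hx, padE_apply_none ψ Q hx]
  | some c =>
    have h : ∀ y : κ, padE ψ P x y * padE ψ Q y z = (ψ y).elim 0 (fun c' => P c c' * padE ψ Q (φ c') z) := by
      intro y
      cases hy : ψ y with
      | none => rw [padE_apply_some_none ψ P hx hy, zero_mul]; rfl
      | some c' =>
        rw [padE_apply_some_some ψ P hx hy]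
        show P c c' * padE ψ Q y z = P c c' * padE ψ Q (φ c') z
        rw [hφψ y c' hy]
    simp_rw [h]
    rw [sum_elim hψφ hφψ]
    cases hz : ψ z with
    | none =>
      rw [padE_apply_some_none ψ (P * Q) hx hz]
      refine (Finset.sum_eq_zero fun c' _ => ?_).symm
      rw [padE_apply_some_none ψ Q (hψφ c') hz, mul_zero]
    | some c'' =>
      rw [padE_apply_some_some ψ (P * Q) hx hz, Matrix.mul_apply]
      refine Finset.sum_congr rfl fun c' _ => ?_
      rw [padE_apply_some_some ψ Q (hψφ c') hz]

section WithDecEq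

variable [DecidableEq ι]

omit [Fintype ι] [Fintype κ] in
/-- `padE` is unital. [folklore] -/
theorem padE_one {φ : ι → κ} {ψ : κ → Option ι} (hφψ : ∀ x c, ψ x = some c → φ c = x) :
    padE ψ (1 : Matrix ι ι ℝ) = (1 : Matrix κ κ ℝ) := by
  ext x y
  rw [Matrix.one_apply]
  cases hx : ψ x with
  | none =>
    rw [padE_apply_none ψ 1 hx]
    by_cases hxy : x = y
    · subst hxy; simp
    · rw [if_neg hxy, if_neg (Ne.symm hxy)]
  | some c =>
    cases hy : ψ y with
    | none =>
      rw [padE_apply_some_none ψ 1 hx hy]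
      have : x ≠ y := fun h => by rw [h, hy] at hx; exact absurd hx (by simp)
      rw [if_neg this]
    | some c' =>
      rw [padE_apply_some_some ψ 1 hx hy, Matrix.one_apply]
      by_cases hcc : c = c'
      · subst hcc
        have : x = y := by rw [← hφψ x c hx, ← hφψ y c hy]
        rw [if_pos this, if_pos rfl]
      · have : x ≠ y := fun h => hcc (by rw [h, hy] at hx; exact (Option.some.inj hx).symm)
        rw [if_neg hcc, if_neg this]

/-- **THE INVERSE OF THE PADDED OPERATOR** is the padded inverse. [folklore] -/
theorem padE_inv {φ : ι → κ} {ψ : κ → Option ι} (hψφ : ∀ c, ψ (φ c) = some c) (hφψ : ∀ x c, ψ x = some c → φ c = x)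
    {P : Matrix ι ι ℝ} (h : P * P⁻¹ = 1) : (padE ψ P)⁻¹ = padE ψ P⁻¹ :=
  Matrix.inv_eq_right_inv (by rw [← padE_mul hψφ hφψ, h, padE_one hφψ])

/-- **THE CUT-OFF COMMUTATOR OF THE PADDED OPERATOR** is the zero-extension of `[diag(l∘φ), P](v∘φ)`. [folklore] -/
theorem comm_padE_mulVec {φ : ι → κ} {ψ : κ → Option ι} (hψφ : ∀ c, ψ (φ c) = some c) (hφψ : ∀ x c, ψ x = some c → φ c = x)
    (l : κ → ℝ) (P : Matrix ι ι ℝ) (v : κ → ℝ) (x : κ) :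
    (comm l (padE ψ P) *ᵥ v) x = (ψ x).elim 0 (fun c => (comm (l ∘ φ) P *ᵥ (v ∘ φ)) c) := by
  simp only [mulVec, dotProduct, comm_apply]
  cases hx : ψ x with
  | none =>
    simp only [Option.elim]
    simp_rw [padE_apply_none ψ P hx]
    simp
  | some c =>
    simp only [Option.elim]
    have h : ∀ y : κ, (l x - l y) * padE ψ P x y * v y =
        (ψ y).elim 0 (fun c' => ((l ∘ φ) c - (l ∘ φ) c') * P c c' * (v ∘ φ) c') := by
      intro y
      cases hy : ψ y with
      | none => rw [padE_apply_some_none ψ P hx hy, mul_zero, zero_mul]; rfl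
      | some c' =>
        rw [padE_apply_some_some ψ P hx hy]
        show (l x - l y) * P c c' * v y = (l (φ c) - l (φ c')) * P c c' * v (φ c')
        rw [hφψ y c' hy, hφψ x c hx]
    simp_rw [h]
    exact sum_elim hψφ hφψ _

/-- the squared norm of the padded commutator is that of the restricted one. [folklore] -/
theorem comm_padE_sq {φ : ι → κ} {ψ : κ → Option ι} (hψφ : ∀ c, ψ (φ c) = some c) (hφψ : ∀ x c, ψ x = some c → φ c = x)
    (l : κ → ℝ) (P : Matrix ι ι ℝ) (v : κ → ℝ) :
    comm l (padE ψ P) *ᵥ v ⬝ᵥ comm l (padE ψ P) *ᵥ v = comm (l ∘ φ) P *ᵥ (v ∘ φ) ⬝ᵥ comm (l ∘ φ) P *ᵥ (v ∘ φ) := by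
  simp only [dotProduct]
  have h : ∀ x : κ, (comm l (padE ψ P) *ᵥ v) x * (comm l (padE ψ P) *ᵥ v) x =
      (ψ x).elim 0 (fun c => (comm (l ∘ φ) P *ᵥ (v ∘ φ)) c * (comm (l ∘ φ) P *ᵥ (v ∘ φ)) c) := by
    intro x
    rw [comm_padE_mulVec hψφ hφψ]
    cases ψ x with
    | none => simp
    | some c => rfl
  rw [Finset.sum_congr rfl fun x _ => h x, sum_elim hψφ hφψ]

/-- **(H-comm) TRANSFERS TO THE PADDED OPERATOR** with the same constants. [folklore] -/
theorem hcomm_padE {φ : ι → κ} {ψ : κ → Option ι} (hψφ : ∀ c, ψ (φ c) = some c) (hφψ : ∀ x c, ψ x = some c → φ c = x)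
    (l : κ → ℝ) (P : Matrix ι ι ℝ) {σ : ℝ} (hσ : 0 ≤ σ) (hPc : ∀ w, σ * (w ⬝ᵥ w) ≤ w ⬝ᵥ P *ᵥ w) {α2 β2 : ℝ}
    (hα : 0 ≤ α2) (hβ : 0 ≤ β2)
    (hcomm : ∀ w, comm (l ∘ φ) P *ᵥ w ⬝ᵥ comm (l ∘ φ) P *ᵥ w ≤ α2 * (w ⬝ᵥ P *ᵥ w) + β2 * (w ⬝ᵥ w)) (v : κ → ℝ) :
    comm l (padE ψ P) *ᵥ v ⬝ᵥ comm l (padE ψ P) *ᵥ v ≤ α2 * (v ⬝ᵥ padE ψ P *ᵥ v) + β2 * (v ⬝ᵥ v) := by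
  rw [comm_padE_sq hψφ hφψ, padE_form hψφ hφψ, dot_split hψφ hφψ v]
  have h0 : 0 ≤ ∑ x ∈ univ.filter (fun x : κ => ψ x = none), v x * v x := Finset.sum_nonneg fun x _ => mul_self_nonneg _
  have h1 := hcomm (v ∘ φ)
  have h2 : 0 ≤ (v ∘ φ) ⬝ᵥ P *ᵥ (v ∘ φ) :=
    le_trans (mul_nonneg hσ (Finset.sum_nonneg fun i _ => mul_self_nonneg _)) (hPc _)
  nlinarith [mul_nonneg hα h0, mul_nonneg hβ h0]

end WithDecEq

omit [Fintype κ] in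
/-- **CUT-OFF COMPATIBILITY TRANSFERS THROUGH PREIMAGES**: if `supp l ⊆ S` and `l ∘ φ` lives on `φ⁻¹ S` for `P`, then `l` lives on `S`
for `padE P` — no comparison with a second operator is needed. [folklore] -/
theorem cutoffOn_padE {φ : ι → κ} {ψ : κ → Option ι} (hφψ : ∀ x c, ψ x = some c → φ c = x) {P : Matrix ι ι ℝ} {l : κ → ℝ}
    {S : Finset κ} (hl : ∀ x, l x ≠ 0 → x ∈ S) (hP : CutoffOn P (l ∘ φ) (univ.filter fun c => φ c ∈ S)) :
    CutoffOn (padE ψ P) l S := by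
  refine ⟨hl, fun x y hlx hyS => ?_⟩
  have hxS : x ∈ S := hl x hlx
  have hxy : x ≠ y := fun h => hyS (h ▸ hxS)
  cases hx : ψ x with
  | none =>
    refine ⟨by rw [padE_apply_none ψ P hx, if_neg hxy.symm], ?_⟩
    cases hy : ψ y with
    | none => rw [padE_apply_none ψ P hy, if_neg hxy]
    | some c' => exact padE_apply_some_none ψ P hy hx
  | some c =>
    have hφc : φ c = x := hφψ x c hx
    have hlc : (l ∘ φ) c ≠ 0 := by rw [Function.comp_apply, hφc]; exact hlx
    cases hy : ψ y with
    | none => exact ⟨padE_apply_some_none ψ P hx hy, by rw [padE_apply_none ψ P hy, if_neg hxy]⟩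
    | some c' =>
      have hφc' : φ c' = y := hφψ y c' hy
      have hc' : c' ∉ univ.filter (fun c => φ c ∈ S) := by
        rw [Finset.mem_filter, not_and, hφc']; exact fun _ => hyS
      obtain ⟨h1, h2⟩ := hP.2 c c' hlc hc'
      exact ⟨by rw [padE_apply_some_some ψ P hx hy, h1], by rw [padE_apply_some_some ψ P hy hx, h2]⟩

end Summit.QuantumFields.BalabanUV.T4Continuum.NE7K1LinWalkPadE

end
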